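import Summits.Ventures.PercRepro.S1TriangleSeven

/-!
# PercRepro — nullity `7`: at most eleven triangles under (C1)–(C3) — the census value `P(7) = 11` (p2, gen 17)

`s₃ ≤ 12` is S1TriangleSeven; the chain S1TriangleSevenB → C → D → E → F removes the value `12`
(SUBCLAIM-S1 v31 §6.3 (xv)). PART 1 (this file): the tools and CASE A — on a coloop-free matroid of nullity `7` with `12` triangles every point has degree `≥ 2`,
and a point of degree exactly `2` is impossible: deleting it leaves an extremal nullity-`6` matroid (ten triangles),
whose non-coloop part has exactly ten points, so it has `≥ 1` new coloops; such a coloop `k` lies on no circuit of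
`M ∖ x`, hence every triangle of `M` through `k` contains `x`; with `t(k) ≥ 2 = t(x)` the point `k` lies on both
triangles through `x`, which meet only in `x` (C1).

* `not_four_distinct_of_ncard_three`; `mul_ncard_ground_add_one_le_three_mul_ncard_triangles` — the lower double
  count with one strict column;
* `triangle_subset_closure_pair` — a triangle lies in the closure of any two of its points;
* `nonColoops_ncard_eq_ten_of_ten_triangles` — the extremal structure at nullity `6`: exactly ten non-coloops;
* **`not_degree_two_of_twelve_triangles`** — CASE A.
Axioms: standard.
-/

open scoped Matroid

namespace PercRepro

namespace S1

open Set

variable {α : Type}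

/-- A set of three elements does not contain four distinct elements. -/
theorem not_four_distinct_of_ncard_three {β : Type} {s : Set β} (hs : s.ncard = 3) (hfin : s.Finite)
    {a b c d : β} (ha : a ∈ s) (hb : b ∈ s) (hc : c ∈ s) (hd : d ∈ s)
    (hab : a ≠ b) (hac : a ≠ c) (had : a ≠ d) (hbc : b ≠ c) (hbd : b ≠ d) (hcd : c ≠ d) : False := by
  have hsub : ({a, b, c, d} : Set β) ⊆ s := by
    intro z hz
    simp only [Set.mem_insert_iff, Set.mem_singleton_iff] at hz
    rcases hz with rfl | rfl | rfl | rfl <;> assumption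
  have h4 : ({a, b, c, d} : Set β).ncard = 4 := by
    rw [Set.ncard_insert_of_notMem, Set.ncard_insert_of_notMem, Set.ncard_pair hcd]
    · simp only [Set.mem_insert_iff, Set.mem_singleton_iff, not_or]
      exact ⟨hbc, hbd⟩
    · simp only [Set.mem_insert_iff, Set.mem_singleton_iff, not_or]
      exact ⟨hab, hac, had⟩
  have := Set.ncard_le_ncard hsub hfin
  omega

/-- **Double count, lower bound with one strict column**: if every point lies on `≥ k` triangles and some point
`y₀` on `≥ k + 1`, then `k·|E| + 1 ≤ 3·s₃`. -/
theorem mul_ncard_ground_add_one_le_three_mul_ncard_triangles (M : Matroid α) [M.Finite] (k : ℕ)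
    (hdeg : ∀ x ∈ M.E, k ≤ (ThmN.trianglesThrough M x).ncard) {y₀ : α} (hy₀ : y₀ ∈ M.E)
    (hy₀k : k + 1 ≤ (ThmN.trianglesThrough M y₀).ncard) :
    k * M.E.ncard + 1 ≤ 3 * (ThmN.triangles M).ncard := by
  classical
  have hTfin : (ThmN.triangles M).Finite :=
    M.ground_finite.finite_subsets.subset (fun C hC => hC.1.subset_ground)
  set Tf : Finset (Set α) := hTfin.toFinset with hTf
  set Ef : Finset α := M.ground_finite.toFinset with hEf
  have hmemT : ∀ C, C ∈ Tf ↔ C ∈ ThmN.triangles M := fun C => Set.Finite.mem_toFinset hTfin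
  have hmemE : ∀ x, x ∈ Ef ↔ x ∈ M.E := fun x => Set.Finite.mem_toFinset M.ground_finite
  have hswap : ∑ x ∈ Ef, ∑ C ∈ Tf, (if x ∈ C then 1 else 0) =
      ∑ C ∈ Tf, ∑ x ∈ Ef, (if x ∈ C then 1 else 0) := Finset.sum_comm
  have hrow : ∀ C ∈ Tf, ∑ x ∈ Ef, (if x ∈ C then 1 else 0) = 3 := by
    intro C hC
    rw [Finset.sum_boole, Nat.cast_id]
    have hCT : C ∈ ThmN.triangles M := (hmemT C).1 hC
    have hCfin : C.Finite := M.ground_finite.subset hCT.1.subset_ground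
    have hfilter : (Ef.filter (fun x => x ∈ C)) = hCfin.toFinset := by
      ext x
      simp only [Finset.mem_filter, Set.Finite.mem_toFinset]
      constructor
      · rintro ⟨-, hx⟩; exact hx
      · intro hx
        exact ⟨(hmemE x).2 (hCT.1.subset_ground hx), hx⟩
    rw [hfilter, ← Set.ncard_eq_toFinset_card C hCfin, hCT.2]
  have hcolcard : ∀ x, (∑ C ∈ Tf, (if x ∈ C then 1 else 0)) = (ThmN.trianglesThrough M x).ncard := by
    intro x
    rw [Finset.sum_boole, Nat.cast_id]
    have hfilter : ((Tf.filter (fun C => x ∈ C)) : Set (Set α)) = ThmN.trianglesThrough M x := by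
      ext C
      simp only [Finset.coe_filter, Set.mem_setOf_eq, hmemT, ThmN.triangles, ThmN.trianglesThrough]
      tauto
    rw [← hfilter, Set.ncard_coe_finset]
  have hleft : ∑ C ∈ Tf, ∑ x ∈ Ef, (if x ∈ C then 1 else 0) = 3 * (ThmN.triangles M).ncard := by
    rw [Finset.sum_congr rfl hrow, Finset.sum_const, smul_eq_mul, hTf,
      ← Set.ncard_eq_toFinset_card _ hTfin, mul_comm]
  have hy₀E : y₀ ∈ Ef := (hmemE y₀).2 hy₀
  have hlt : ∑ _x ∈ Ef, k < ∑ x ∈ Ef, ∑ C ∈ Tf, (if x ∈ C then 1 else 0) := by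
    refine Finset.sum_lt_sum ?_ ⟨y₀, hy₀E, ?_⟩
    · intro x hx
      rw [hcolcard x]
      exact hdeg x ((hmemE x).1 hx)
    · rw [hcolcard y₀]
      omega
  rw [Finset.sum_const, smul_eq_mul, hEf, ← Set.ncard_eq_toFinset_card _ M.ground_finite, hswap,
    hleft] at hlt
  rw [Nat.mul_comm]
  omega

/-- **A triangle lies in the closure of any two of its points.** -/
theorem triangle_subset_closure_pair (M : Matroid α) [M.Finite] {T : Set α} (hT : T ∈ ThmN.triangles M)
    {a b : α} (ha : a ∈ T) (hb : b ∈ T) (hab : a ≠ b) : T ⊆ M.closure {a, b} := by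
  have hTfin : T.Finite := M.ground_finite.subset hT.1.subset_ground
  have hTE : T ⊆ M.E := hT.1.subset_ground
  have hpairE : ({a, b} : Set α) ⊆ M.E := Set.insert_subset (hTE ha) (Set.singleton_subset_iff.2 (hTE hb))
  intro c hc
  by_cases hca : c = a
  · rw [hca]; exact M.mem_closure_of_mem (by simp) hpairE
  by_cases hcb : c = b
  · rw [hcb]; exact M.mem_closure_of_mem (by simp) hpairE
  -- `T \ {c} = {a, b}`
  have hsub : ({a, b} : Set α) ⊆ T \ {c} := by
    intro z hz
    simp only [Set.mem_insert_iff, Set.mem_singleton_iff] at hz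
    rcases hz with rfl | rfl
    · exact ⟨ha, fun h => hca (Set.mem_singleton_iff.1 h).symm⟩
    · exact ⟨hb, fun h => hcb (Set.mem_singleton_iff.1 h).symm⟩
  have hcard : (T \ {c}).ncard ≤ ({a, b} : Set α).ncard := by
    rw [Set.ncard_pair hab, Set.ncard_sdiff_singleton_of_mem hc, hT.2]
  have heq : T \ {c} = {a, b} := (Set.eq_of_subset_of_ncard_le hsub hcard (hTfin.subset Set.sdiff_subset)).symm
  have := hT.1.mem_closure_sdiff_singleton_of_mem hc
  rw [heq] at this
  exact this

/-- **The extremal structure at nullity `6`**: a matroid of nullity `6` with exactly ten triangles has exactly ten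
non-coloops (its coloops `K`: `|E ∖ K| = 10`). -/
theorem nonColoops_ncard_eq_ten_of_ten_triangles (M : Matroid α) [M.Finite]
    (hC1 : ∀ L ⊆ M.E, M.eRk L = 2 → L.ncard ≤ 3) (hC2 : ∀ P ⊆ M.E, M.eRk P ≤ 3 → P.ncard ≤ 6)
    (hC3 : ∀ X ⊆ M.E, M.eRk X ≤ 4 → X.ncard ≤ 10) (hd : M.E.encard = M.eRank + ((6 : ℕ) : ℕ∞))
    (hs10 : (ThmN.triangles M).ncard = 10) :
    ∃ K : Set α, (∀ k, k ∈ K ↔ k ∈ M.E ∧ M.IsColoop k) ∧ (M.E \ K).ncard = 10 := by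
  classical
  have hEfin : M.E.Finite := M.ground_finite
  obtain ⟨K, hK⟩ : ∃ K : Set α, ∀ k, k ∈ K ↔ k ∈ M.E ∧ M.IsColoop k :=
    ⟨{k ∈ M.E | M.IsColoop k}, fun k => Iff.rfl⟩
  refine ⟨K, hK, ?_⟩
  have hKE : K ⊆ M.E := fun k hk => ((hK k).1 hk).1
  have hKfin : K.Finite := hEfin.subset hKE
  have hKcol : ∀ k ∈ hKfin.toFinset, M.IsColoop k :=
    fun k hk => ((hK k).1 ((Set.Finite.mem_toFinset hKfin).1 hk)).2
  have hKcoe : ((hKfin.toFinset : Finset α) : Set α) = K := Set.Finite.coe_toFinset hKfin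
  obtain ⟨hd'', htri''⟩ := delete_coloops_encard_triangles M hKfin.toFinset hKcol (d := 6) hd
  rw [hKcoe] at hd'' htri''
  set M'' := M ＼ K with hM''
  have hE'' : M''.E = M.E \ K := rfl
  have hs10'' : (ThmN.triangles M'').ncard = 10 := by rw [htri'']; exact hs10
  have hC1'' : ∀ L ⊆ M''.E, M''.eRk L = 2 → L.ncard ≤ 3 := by
    intro L hL hr
    rw [hE''] at hL
    rw [hM'', delete_eRk_eq_of_sdiff M K hL] at hr
    exact hC1 L (hL.trans Set.sdiff_subset) hr
  have hC2'' : ∀ P ⊆ M''.E, M''.eRk P ≤ 3 → P.ncard ≤ 6 := by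
    intro P hP hr
    rw [hE''] at hP
    rw [hM'', delete_eRk_eq_of_sdiff M K hP] at hr
    exact hC2 P (hP.trans Set.sdiff_subset) hr
  have hC3'' : ∀ X ⊆ M''.E, M''.eRk X ≤ 4 → X.ncard ≤ 10 := by
    intro X hX hr
    rw [hE''] at hX
    rw [hM'', delete_eRk_eq_of_sdiff M K hX] at hr
    exact hC3 X (hX.trans Set.sdiff_subset) hr
  -- `M''` is coloop-free
  have hfree'' : ∀ y ∈ M''.E, ¬ M''.IsColoop y := by
    intro y hy hcy
    have hyE : y ∈ M.E := hy.1
    have hyK : y ∉ K := hy.2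
    apply hyK
    refine (hK y).2 ⟨hyE, ?_⟩
    rw [hM'', _root_.Matroid.delete_isColoop_iff] at hcy
    obtain ⟨hcy1, -, -⟩ := hcy
    rw [_root_.Matroid.isColoop_iff_notMem_closure_compl hyE]
    have hsplit : M.E \ {y} = ((M.E \ K) \ {y}) ∪ K := by
      ext z
      simp only [Set.mem_sdiff, Set.mem_singleton_iff, Set.mem_union]
      constructor
      · rintro ⟨hzE, hzy⟩
        by_cases hzK : z ∈ K
        · exact Or.inr hzK
        · exact Or.inl ⟨⟨hzE, hzK⟩, hzy⟩
      · rintro (⟨⟨hzE, -⟩, hzy⟩ | hzK)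
        · exact ⟨hzE, hzy⟩
        · exact ⟨hKE hzK, fun h => hyK (h ▸ hzK)⟩
    rw [hsplit, _root_.Matroid.closure_union_eq_of_subset_coloops _ (fun k hk => ((hK k).1 hk).2)]
    rintro (h | h)
    · exact hcy1 h
    · exact hyK h
  -- `≤ 10`: every point of `M''` lies on `≥ 3` of its ten triangles
  have hdeg'' : ∀ y ∈ M''.E, 3 ≤ (ThmN.trianglesThrough M'' y).ncard := by
    intro y hy
    obtain ⟨hd3, hC1y, hC2y, hley⟩ :=
      ncard_triangles_le_add_of_not_isColoop M'' hC1'' hC2'' (d := 5) hd'' hy (hfree'' y hy)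
    have h7 := ncard_triangles_le_seven_of_nullity_five (M'' ＼ {y}) hC1y hC2y hd3
    omega
  have hN10 : (M.E \ K).ncard ≤ 10 := by
    have := mul_ncard_ground_le_three_mul_ncard_triangles M'' 3 hdeg''
    rw [hE'', hs10''] at this
    omega
  -- `≥ 10`: the rank facts on `M''`
  obtain ⟨C'', hC''⟩ : (ThmN.triangles M'').Nonempty := by
    rw [← Set.ncard_pos (M''.ground_finite.finite_subsets.subset (fun C hC => hC.1.subset_ground))]
    omega
  obtain ⟨r'', hr'', hnr'', hr2''⟩ := two_add_le_eRank_of_triangle M'' hd'' hC''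
  have hE2'' : r'' ≠ 2 ∨ M''.E.ncard ≤ 3 := by
    by_cases h : r'' = 2
    · refine Or.inr (hC1'' M''.E (subset_refl _) ?_)
      rw [← _root_.Matroid.eRank_def, hr'', h]; norm_num
    · exact Or.inl h
  have hE3'' : r'' ≠ 3 ∨ M''.E.ncard ≤ 6 := by
    by_cases h : r'' = 3
    · refine Or.inr (hC2'' M''.E (subset_refl _) ?_)
      rw [← _root_.Matroid.eRank_def, hr'', h]; norm_num
    · exact Or.inl h
  rw [hE''] at hnr'' hE2'' hE3''
  omega

/-- **CASE A**: on a coloop-free matroid of nullity `7` with twelve triangles no point has degree `2`. -/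
theorem not_degree_two_of_twelve_triangles (M : Matroid α) [M.Finite]
    (hC1 : ∀ L ⊆ M.E, M.eRk L = 2 → L.ncard ≤ 3) (hC2 : ∀ P ⊆ M.E, M.eRk P ≤ 3 → P.ncard ≤ 6)
    (hC3 : ∀ X ⊆ M.E, M.eRk X ≤ 4 → X.ncard ≤ 10) (hd : M.E.encard = M.eRank + ((7 : ℕ) : ℕ∞))
    (hcol : ∀ x ∈ M.E, ¬ M.IsColoop x) (hs12 : (ThmN.triangles M).ncard = 12)
    (hm12 : 12 ≤ M.E.ncard) {x : α} (hxE : x ∈ M.E) (hx2 : (ThmN.trianglesThrough M x).ncard = 2) :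
    False := by
  classical
  -- every point has degree `≥ 2`
  have hdeg2 : ∀ y ∈ M.E, 2 ≤ (ThmN.trianglesThrough M y).ncard := by
    intro y hy
    obtain ⟨hd', hC1', hC2', hle⟩ :=
      ncard_triangles_le_add_of_not_isColoop M hC1 hC2 (d := 6) hd hy (hcol y hy)
    have hC3' : ∀ X ⊆ (M ＼ {y}).E, (M ＼ {y}).eRk X ≤ 4 → X.ncard ≤ 10 := by
      intro X hX hr
      rw [_root_.Matroid.delete_ground] at hX
      rw [delete_singleton_eRk_eq hX] at hr
      exact hC3 X (hX.trans Set.sdiff_subset) hr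
    have h10 := ncard_triangles_le_cq (M ＼ {y}) hC1' hC2' hC3' hd'
    rw [show cq 6 = 10 by decide] at h10
    omega
  -- `M' = M ∖ x` has nullity `6` and exactly ten triangles
  obtain ⟨hd', hC1', hC2', hle⟩ :=
    ncard_triangles_le_add_of_not_isColoop M hC1 hC2 (d := 6) hd hxE (hcol x hxE)
  have hC3' : ∀ X ⊆ (M ＼ {x}).E, (M ＼ {x}).eRk X ≤ 4 → X.ncard ≤ 10 := by
    intro X hX hr
    rw [_root_.Matroid.delete_ground] at hX
    rw [delete_singleton_eRk_eq hX] at hr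
    exact hC3 X (hX.trans Set.sdiff_subset) hr
  have h10 := ncard_triangles_le_cq (M ＼ {x}) hC1' hC2' hC3' hd'
  rw [show cq 6 = 10 by decide] at h10
  have hs10 : (ThmN.triangles (M ＼ {x})).ncard = 10 := by omega
  obtain ⟨K, hK, hNK⟩ := nonColoops_ncard_eq_ten_of_ten_triangles (M ＼ {x}) hC1' hC2' hC3' hd' hs10
  have hKE' : K ⊆ (M ＼ {x}).E := fun k hk => ((hK k).1 hk).1
  have hE'fin : (M ＼ {x}).E.Finite := (M ＼ {x}).ground_finite
  have hE'card : (M ＼ {x}).E.ncard + 1 = M.E.ncard := by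
    rw [_root_.Matroid.delete_ground]; exact Set.ncard_sdiff_singleton_add_one hxE M.ground_finite
  have hNKcard : ((M ＼ {x}).E \ K).ncard + K.ncard = (M ＼ {x}).E.ncard :=
    Set.ncard_sdiff_add_ncard_of_subset hKE' hE'fin
  have hKfin : K.Finite := hE'fin.subset hKE'
  obtain ⟨k, hk⟩ : K.Nonempty := by
    rw [← Set.ncard_pos hKfin]; omega
  have hkE' : k ∈ (M ＼ {x}).E := hKE' hk
  have hkc : (M ＼ {x}).IsColoop k := ((hK k).1 hk).2
  have hkx : k ≠ x := fun h => hkE'.2 (by rw [Set.mem_singleton_iff]; exact h)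
  -- every triangle through `k` contains `x`
  have hsub : ThmN.trianglesThrough M k ⊆ ThmN.trianglesThrough M x := by
    intro T hT
    refine ⟨hT.1, hT.2.1, ?_⟩
    by_contra hxT
    have hT' : (M ＼ {x}).IsCircuit T := by
      rw [_root_.Matroid.delete_isCircuit_iff]
      exact ⟨hT.1, Set.disjoint_singleton_right.2 hxT⟩
    exact hkc.notMem_isCircuit hT' hT.2.2
  have hTfin : (ThmN.trianglesThrough M x).Finite :=
    M.ground_finite.finite_subsets.subset (fun C hC => hC.1.subset_ground)
  have hkdeg := hdeg2 k hkE'.1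
  have heq : ThmN.trianglesThrough M k = ThmN.trianglesThrough M x :=
    Set.eq_of_subset_of_ncard_le hsub (by omega) hTfin
  -- the two triangles through `x` both contain `k`
  obtain ⟨T₁, T₂, hne, hT12⟩ := Set.ncard_eq_two.1 hx2
  have h1 : T₁ ∈ ThmN.trianglesThrough M x := by rw [hT12]; exact Set.mem_insert _ _
  have h2 : T₂ ∈ ThmN.trianglesThrough M x := by rw [hT12]; exact Set.mem_insert_of_mem _ rfl
  have hk1 : k ∈ T₁ := by
    have : T₁ ∈ ThmN.trianglesThrough M k := by rw [heq]; exact h1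
    exact this.2.2
  have hk2 : k ∈ T₂ := by
    have : T₂ ∈ ThmN.trianglesThrough M k := by rw [heq]; exact h2
    exact this.2.2
  have hinter := ThmN.inter_eq_singleton_of_mem_trianglesThrough M hC1 h1 h2 hne
  have : k ∈ T₁ ∩ T₂ := ⟨hk1, hk2⟩
  rw [hinter, Set.mem_singleton_iff] at this
  exact hkx this


end S1

end PercRepro
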